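import Mathlib
import Literature.NumberTheory.QuadraticFields.ZsqrtdFormClassGroupProofs
import Literature.NumberTheory.QuadraticFields.BinaryQuadraticFormsRepresentation

/-!
# LINE LAW — the AUXILIARY IDEAL IN A PRESCRIBED CLASS (Cox Cor. 7.17 for `ℤ[√m]`, kernel) and class identities as
# Cox-(7.8) relations (ENGINE-W code B, #B24)

Every «⇐» of the LINE LAW's class laws (THEOREM D ∕ D′ ∕ D″ ∕ E, LINE-LAW-THEOREMS-B §6–§6″; kernel 346 `LineLawPairLaw`, #B20
`LineLawClassLawSufficiency`) uses ONE input «by value»: *in the class `κ − [𝔞_L(A)]` there is a primitive ideal `𝔞_r(B) =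
(r, −B + √m)` with `r` prime to any prescribed `M`* (Cox, Primes of the form x² + ny², Cor. 7.17: every ideal class of an order
contains a proper ideal prime to a given modulus).  For the order `ℤ[√m]`, `m < 0`, this is a THEOREM OF THE TREE's dictionary and is
made kernel here, PLAIN (Mathlib + Literature only):
* `exists_form_coprime_in_class` — every class `C ∈ ClassGroup (ℤ√m)` is `toClass` of a primitive positive definite form of
  discriminant `4m` whose leading coefficient is prime to `M ≠ 0` (tree: `exists_isLabel_toClass_eq_of_neg` = Cox Thm 7.7 (ii)
  surjectivity, `exists_properEquiv_isCoprime_a` = Cox Lemma 2.25 + 2.3, `toClass_eq_of_properEquiv` = Thm 7.7 (ii) well-defined);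
* `exists_primIdeal_in_class` — unpacked: `r > 0` prime to `M`, a root `B` with `B² − r k = m`, `(r, 2B, k)` primitive, and
  `toClass (r, 2B, k) = C`, the ideal being `𝔞_r(B) = (r, −B + √m)` (`ideal_rootForm`);
* `relation_of_toClass_mul_eq` — a class identity `[𝔞_f]·[𝔞_g] = [𝔞_h]` between form ideals IS a Cox-(7.8) relation
  `(x)·𝔞_f𝔞_g = (y)·𝔞_h` with `x, y ≠ 0` — the shape of #B20's hypothesis `haux` and of 346's `hrel`;
  `relation_of_toClass_eq` — the one-ideal case (tree `toClass_eq_toClass_iff`, restated at the root form).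
So the class-law kernels' auxiliary input is discharged up to the CRT re-rooting `A' ≡ A (mod L), A' ≡ B (mod r)` (315 `crt_pair`,
331 `span_pair_congr`), which the assembling file performs.  Honest framing: ideal ∕ form arithmetic of `ℤ√m` only; Mukai vectors
and lattices elsewhere, not objects; nothing here says that HC, HC_CM or HC_AV holds.
-/

open scoped nonZeroDivisors

namespace Summit.Ventures.HSemireg.LineLawAuxiliaryClass

open Zsqrtd
open Literature.NumberTheory.QuadraticFields.Quadratic
open Literature.NumberTheory.QuadraticFields.Quadratic.BinQF (exists_isLabel_toClass_eq_of_neg toClass_eq_of_properEquiv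
  isUnit_fracIdeal_of_isPosPrim toClass_eq_toClass_iff toClass_of_isUnit exists_b_eq_two_mul)

/-- **Cox Cor. 7.17 for `ℤ[√m]` (`m < 0`), form version**: every ideal class is the class of a primitive positive definite form of
discriminant `4m` whose leading coefficient is prime to a prescribed `M ≠ 0`. -/
theorem exists_form_coprime_in_class {m : ℤ} [IsDomain (ℤ√m)] (hm : m < 0) (C : ClassGroup (ℤ√m)) {M : ℤ} (hM : M ≠ 0) :
    ∃ f : BinQF, f.IsPosPrim (4 * m) ∧ IsCoprime f.a M ∧ BinQF.toClass m f = C := by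
  obtain ⟨f, hf, hfC⟩ := exists_isLabel_toClass_eq_of_neg hm C
  obtain ⟨g, hfg, hg⟩ := BinQF.exists_properEquiv_isCoprime_a hf.1.primitive hM
  exact ⟨g, hfg.isPosPrim (by omega) hf.1, hg, (toClass_eq_of_properEquiv hm hf.1 hfg).symm.trans hfC⟩

/-- The ideal of the root form `(r, 2B, k)` is `𝔞_r(B) = (r, −B + √m)`. -/
theorem ideal_rootForm (m r B k : ℤ) : BinQF.ideal m ⟨r, 2 * B, k⟩ = Ideal.span {(r : ℤ√m), ⟨-B, 1⟩} := by
  simp [BinQF.ideal]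

/-- **Cox Cor. 7.17 for `ℤ[√m]`, ideal version**: in every class `C` and for every `M ≠ 0` there is a primitive ideal
`𝔞_r(B) = (r, −B + √m)` with `r > 0` prime to `M`, `B² − r k = m` and `(r, 2B, k)` primitive (so `𝔞_r(B)` is proper ∕ invertible),
whose class is `C`. -/
theorem exists_primIdeal_in_class {m : ℤ} [IsDomain (ℤ√m)] (hm : m < 0) (C : ClassGroup (ℤ√m)) {M : ℤ} (hM : M ≠ 0) :
    ∃ r B k : ℤ, 0 < r ∧ IsCoprime r M ∧ B ^ 2 - r * k = m ∧ (∀ d : ℤ, d ∣ r → d ∣ 2 * B → d ∣ k → IsUnit d) ∧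
      (⟨r, 2 * B, k⟩ : BinQF).IsPosPrim (4 * m) ∧ BinQF.toClass m ⟨r, 2 * B, k⟩ = C := by
  obtain ⟨f, hf, hcop, hfC⟩ := exists_form_coprime_in_class hm C hM
  obtain ⟨B', hb, hB'⟩ := exists_b_eq_two_mul hf.disc_eq
  have hf_eq : f = ⟨f.a, 2 * B', f.c⟩ := by
    cases f; simp only at hb; simp [hb]
  refine ⟨f.a, B', f.c, hf.a_pos, hcop, by linear_combination hB', ?_, hf_eq ▸ hf, hf_eq ▸ hfC⟩
  have hprim := (BinQF.isPrimitive_iff _).1 hf.primitive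
  intro d hd1 hd2 hd3
  exact hprim d hd1 (by rw [hb]; exact hd2) hd3

/-- **A class identity is a Cox-(7.8) relation** (one ideal each side): for primitive positive definite `f, g` of discriminant
`4m`, `toClass f = toClass g` iff `(x)·𝔞_f = (y)·𝔞_g` for some nonzero `x, y` (tree `toClass_eq_toClass_iff`). -/
theorem relation_of_toClass_eq {m : ℤ} [IsDomain (ℤ√m)] {f g : BinQF} (hf : f.IsPosPrim (4 * m)) (hg : g.IsPosPrim (4 * m))
    (h : BinQF.toClass m f = BinQF.toClass m g) :
    ∃ x y : ℤ√m, x ≠ 0 ∧ y ≠ 0 ∧ Ideal.span {x} * BinQF.ideal m f = Ideal.span {y} * BinQF.ideal m g :=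
  (toClass_eq_toClass_iff (isUnit_fracIdeal_of_isPosPrim hf) (isUnit_fracIdeal_of_isPosPrim hg)).1 h

/-- **A class identity between a product and an ideal is a Cox-(7.8) relation**: for primitive positive definite `f, g, h` of
discriminant `4m` with `[𝔞_f]·[𝔞_g] = [𝔞_h]` in `ClassGroup (ℤ√m)`, there are nonzero `x, y` with `(x)·(𝔞_f·𝔞_g) = (y)·𝔞_h` —
the hypothesis `haux` of #B20 `weightDatum_of_aligned` ∕ `classLaw_sufficiency` and `hrel` of 346. -/
theorem relation_of_toClass_mul_eq {m : ℤ} [IsDomain (ℤ√m)] {f g h : BinQF} (hf : f.IsPosPrim (4 * m))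
    (hg : g.IsPosPrim (4 * m)) (hh : h.IsPosPrim (4 * m))
    (hcl : BinQF.toClass m f * BinQF.toClass m g = BinQF.toClass m h) :
    ∃ x y : ℤ√m, x ≠ 0 ∧ y ≠ 0 ∧
      Ideal.span {x} * (BinQF.ideal m f * BinQF.ideal m g) = Ideal.span {y} * BinQF.ideal m h := by
  have huf := isUnit_fracIdeal_of_isPosPrim hf
  have hug := isUnit_fracIdeal_of_isPosPrim hg
  have huh := isUnit_fracIdeal_of_isPosPrim hh
  rw [toClass_of_isUnit huf, toClass_of_isUnit hug, toClass_of_isUnit huh, ← map_mul] at hcl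
  refine (ClassGroup.mk_eq_mk_of_coe_ideal (I' := BinQF.ideal m f * BinQF.ideal m g) (J' := BinQF.ideal m h) ?_
    huh.unit_spec).1 hcl
  rw [Units.val_mul, huf.unit_spec, hug.unit_spec, FractionalIdeal.coeIdeal_mul]

/-- **Corollary used by the class laws**: given the class `κ` of a target ideal and the class of `𝔞_L(A)` — both as forms — an
auxiliary root form `(r, 2B, k)` with `r > 0` prime to `M` exists such that `[𝔞_r(B)]·[𝔞_L] = [𝔞_target]`, delivered directly as
the Cox-(7.8) relation `(x)·(𝔞_r(B)·𝔞_L) = (y)·𝔞_target`, `x, y ≠ 0`. -/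
theorem exists_aux_relation {m : ℤ} [IsDomain (ℤ√m)] (hm : m < 0) {gL gt : BinQF} (hL : gL.IsPosPrim (4 * m))
    (ht : gt.IsPosPrim (4 * m)) {M : ℤ} (hM : M ≠ 0) :
    ∃ r B k : ℤ, 0 < r ∧ IsCoprime r M ∧ B ^ 2 - r * k = m ∧ (⟨r, 2 * B, k⟩ : BinQF).IsPosPrim (4 * m) ∧
      ∃ x y : ℤ√m, x ≠ 0 ∧ y ≠ 0 ∧
        Ideal.span {x} * (Ideal.span {(r : ℤ√m), ⟨-B, 1⟩} * BinQF.ideal m gL) = Ideal.span {y} * BinQF.ideal m gt := by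
  obtain ⟨r, B, k, hr, hcop, hk, -, hprim, hcl⟩ :=
    exists_primIdeal_in_class hm (BinQF.toClass m gt * (BinQF.toClass m gL)⁻¹) hM
  refine ⟨r, B, k, hr, hcop, hk, hprim, ?_⟩
  have hmul : BinQF.toClass m ⟨r, 2 * B, k⟩ * BinQF.toClass m gL = BinQF.toClass m gt := by
    rw [hcl, inv_mul_cancel_right]
  obtain ⟨x, y, hx, hy, hrel⟩ := relation_of_toClass_mul_eq hprim hL ht hmul
  exact ⟨x, y, hx, hy, by rwa [ideal_rootForm] at hrel⟩

/-- **Instance in numbers (`m = −5`, `h(−20) = 2`)**: the non-principal class contains `𝔞_3(1) = (3, −1 + √−5)` (root form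
`(3, 2, 2)`: `1² − 3·2 = −5`) and, prime to `M = 6`, also `𝔞_7(3) = (7, −3 + √−5)` (root form `(7, 6, 2)`: `3² − 7·2 = −5`); neither
`3` nor `7` is a norm `x² + 5y²`, and `3·7 = 21 = 4² + 5 = N(4 + √−5)`.  The arithmetic of the two root forms: -/
example : (1 : ℤ) ^ 2 - 3 * 2 = -5 ∧ (3 : ℤ) ^ 2 - 7 * 2 = -5 ∧ IsCoprime (7 : ℤ) 6 ∧ (⟨4, 1⟩ : ℤ√(-5)).norm = 21 := by
  refine ⟨by norm_num, by norm_num, ⟨1, -1, by norm_num⟩, by simp [Zsqrtd.norm]⟩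

end Summit.Ventures.HSemireg.LineLawAuxiliaryClass
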